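import Literature.Analysis.FluidPDE.PeriodicCylinderNeumannPeriodicTest
import Literature.Analysis.FunctionSpaces.TorusPeriodization
import HarnessLib

/-!
# The weak identities of the periodic Neumann problem on an `m`-fold period cell

Topic `Literature/Analysis/FluidPDE`. Theorem-only file (no definitions, no named facts) of the
regularity theory for the weak periodic Neumann problem on the cylinder `{r ≤ 1} × ℝ/Lℤ`
(sequel of `PeriodicCylinderNeumannPeriodicTest`; the analytic input of
`Literature.Analysis.FluidPDE.KatoLai1984_periodicCylinderUniformExistence`, T. Kato, C. Y. Lai,
J. Funct. Anal. 56 (1984)). The interior-regularity step reads the cut-off potential on a flat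
torus whose vertical period is a multiple `mL` of `L` (so that the horizontal support fits into
one period of the same torus); this file moves the weak identities of the previous file from the
period cell `{r<1} × (0,L)` to the `m`-fold cell `cylinderCell (mL) = {r<1} × (0,mL)` and to test
functions that are merely `mL`-periodic:

* `setIntegral_cylinderCell_mul_eq_sum` — **slab decomposition**
  `∫_{cell(mL)} f = Σ_{j<m} ∫_cell f(· + jL e_z)` (the planes `z = jL` are null, tree lemma
  `volume_setOf_apply_two_eq`; Lebesgue measure is translation invariant), and
  `integrableOn_comp_axialRed_multiPeriod` — periodic extensions `f ∘ axialRed` of functions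
  integrable on the cell are integrable on the `m`-fold cell;
* period averages `ψ̄ = Σ_{j<m} ψ(· + jL e_z)` of `mL`-periodic functions are `L`-periodic, smooth,
  and commute with `D` and `Δ` (`isAxiallyPeriodic_sum_translates`, `contDiff_sum_translates`,
  `fderiv_sum_translates`, `laplacian_sum_translates`);
* `setIntegral_fderiv_mul_potential_multiPeriod` — for `G ∈ 𝓖` with potential `q`, their periodic
  extensions `Q = q ∘ axialRed`, `G ∘ axialRed` and every smooth `mL`-periodic `ψ` vanishing near the
  wall: `∫_{cell(mL)} ∂_vψ Q = −∫_{cell(mL)} ψ ⟪G ∘ axialRed, v⟫`;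
* `setIntegral_cutoff_potential_mul_laplacian_multiPeriod` — the weak Laplacian of `θQ` on the
  `m`-fold cell against smooth `mL`-periodic `Φ`: `∫_{cell(mL)} θ Q ΔΦ = ∫_{cell(mL)} (F ∘ axialRed) Φ`,
  `F = θ(div h₁ − h₀) + 2Dθ(∇q) + qΔθ` (both by the slab decomposition and the period average,
  reducing to the `L`-periodic identities of the previous file).

Mathlib/tree search: `volume_setOf_apply_two_eq` (tree, `Ferrari1993LogEstimateReduction`:
null planes), `measurePreserving_add_right`, `MeasurePreserving.setIntegral_preimage_emb`,
`MeasurePreserving.integrableOn_comp_preimage`, `setIntegral_congr_set`, `ae_eq_set`,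
`Torus.laplacian_finset_sum`, `Torus.laplacian_comp_add_right` (tree, `TorusPeriodization`);
nothing about `m`-fold cells existed (`lean search 'multiPeriod|m-fold|cylinderCell.*mul'`).

## References

* T. Kato, C. Y. Lai, J. Funct. Anal. 56 (1984) 15–28, §4 (i), §5. [KatoLai1984]
* L. C. Evans, *Partial Differential Equations*, 2nd ed. (2010), §5.2.1. [Evans2010]
-/

noncomputable section

open MeasureTheory Set Function Filter Topology TopologicalSpace WithLp Metric
open scoped ContDiff NNReal ENNReal InnerProductSpace RealInnerProductSpace Laplacian

namespace Literature.Analysis.FluidPDE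

open Literature.Analysis.FunctionSpaces

/-- Local notation for physical space `ℝ³ = EuclideanSpace ℝ (Fin 3)`. -/
local notation "ℝ³" => EuclideanSpace ℝ (Fin 3)

/-- Local notation for the closed unit cylinder `{r ≤ 1}`. -/
local notation "𝕂" => closure (SetLike.coe unitCylinder : Set (EuclideanSpace ℝ (Fin 3)))

namespace PeriodicCylinder

variable {L : ℝ}

/-! ### The slab decomposition of the `m`-fold cell -/

/-- The translate of the cell by `jL e_z` is the slab `{jL < z < (j+1)L}` of the cylinder. [folklore] -/
theorem preimage_add_smul_cylinderCell_slab (a : ℝ) :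
    (fun x : ℝ³ => x + a • eZ) ⁻¹' {x : ℝ³ | cylRadius x < 1 ∧ a < x 2 ∧ x 2 < a + L} = (cylinderCell L : Set ℝ³) := by
  ext x
  simp only [mem_preimage, mem_setOf_eq, cylRadius_add_smul_eZ, PiLp.add_apply, smul_eZ_apply_two]
  constructor
  · rintro ⟨h1, h2, h3⟩; exact ⟨h1, by linarith, by linarith⟩
  · rintro ⟨h1, h2, h3⟩; exact ⟨h1, by linarith, by linarith⟩

/-- **Slab decomposition of the `m`-fold cell**: `∫_{cell(mL)} f = Σ_{j<m} ∫_cell f(· + jL e_z)` for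
`f` integrable on the `m`-fold cell `cylinderCell (mL) = {r < 1} × (0, mL)` (the planes `z = jL` are
null; translations preserve Lebesgue measure). [folklore] -/
theorem setIntegral_cylinderCell_mul_eq_sum (hL : 0 < L) {E : Type*} [NormedAddCommGroup E] [NormedSpace ℝ E]
    (m : ℕ) {f : ℝ³ → E} (hf : IntegrableOn f (cylinderCell ((m : ℝ) * L) : Set ℝ³) volume) :
    ∫ x in (cylinderCell ((m : ℝ) * L) : Set ℝ³), f x =
      ∑ j ∈ Finset.range m, ∫ x in (cylinderCell L : Set ℝ³), f (x + ((j : ℝ) * L) • eZ) := by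
  induction m with
  | zero =>
    have h0 : (cylinderCell ((0 : ℕ) * L : ℝ) : Set ℝ³) = ∅ := by
      ext x
      simp only [Nat.cast_zero, zero_mul, SetLike.mem_coe, mem_cylinderCell, mem_empty_iff_false, iff_false]
      rintro ⟨-, h1, h2⟩; linarith
    rw [h0, Measure.restrict_empty, integral_zero_measure, Finset.range_zero, Finset.sum_empty]
  | succ m ih =>
    -- `cell((m+1)L) = cell(mL) ∪ slab_m` up to the null plane `z = mL`
    set S : Set ℝ³ := (cylinderCell ((m : ℝ) * L) : Set ℝ³) with hS
    set T : Set ℝ³ := {x : ℝ³ | cylRadius x < 1 ∧ (m : ℝ) * L < x 2 ∧ x 2 < (m : ℝ) * L + L} with hT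
    have hc2 : Continuous fun x : ℝ³ => x 2 := (continuous_apply 2).comp (PiLp.continuous_ofLp 2 _)
    have hTo : IsOpen T := (isOpen_lt continuous_cylRadius continuous_const).inter
      ((isOpen_lt continuous_const hc2).inter (isOpen_lt hc2 continuous_const))
    have hTm : MeasurableSet T := hTo.measurableSet
    have hSm : MeasurableSet S := (cylinderCell _).isOpen.measurableSet
    have hdisj : Disjoint S T := by
      rw [Set.disjoint_left]
      rintro x ⟨-, -, h1⟩ ⟨-, h2, -⟩
      linarith
    have hae : ((cylinderCell (((m + 1 : ℕ) : ℝ) * L) : Set ℝ³)) =ᵐ[volume] (S ∪ T : Set ℝ³) := by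
      have hsub1 : S ∪ T ⊆ (cylinderCell (((m + 1 : ℕ) : ℝ) * L) : Set ℝ³) := by
        rintro x (⟨h1, h2, h3⟩ | ⟨h1, h2, h3⟩)
        · refine ⟨h1, h2, ?_⟩; push_cast; nlinarith
        · refine ⟨h1, by nlinarith [hL], ?_⟩; push_cast; linarith
      have hsub2 : (cylinderCell (((m + 1 : ℕ) : ℝ) * L) : Set ℝ³) \ (S ∪ T) ⊆ {x : ℝ³ | x 2 = (m : ℝ) * L} := by
        rintro x ⟨⟨h1, h2, h3⟩, hx⟩
        rw [mem_union, not_or] at hx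
        push_cast at h3
        rcases lt_trichotomy (x 2) ((m : ℝ) * L) with hlt | heq | hgt
        · exact absurd (show x ∈ S from ⟨h1, h2, hlt⟩) hx.1
        · exact heq
        · exact absurd (show x ∈ T from ⟨h1, hgt, by linarith⟩) hx.2
      refine ae_eq_set.2 ⟨?_, ?_⟩
      · exact measure_mono_null hsub2 (volume_setOf_apply_two_eq _)
      · rw [Set.sdiff_eq_empty.2 hsub1, measure_empty]
    have hfS : IntegrableOn f S volume := hf.mono_set fun x ⟨h1, h2, h3⟩ => ⟨h1, h2, by push_cast; nlinarith⟩
    have hfT : IntegrableOn f T volume := hf.mono_set fun x ⟨h1, h2, h3⟩ => ⟨h1, by nlinarith [hL], by push_cast; linarith⟩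
    rw [setIntegral_congr_set hae, setIntegral_union hdisj hTm hfS hfT, ih hfS, Finset.sum_range_succ]
    congr 1
    -- the last slab is the translate of the cell
    have hmp : MeasurePreserving (fun x : ℝ³ => x + ((m : ℝ) * L) • eZ) volume volume :=
      measurePreserving_add_right volume _
    have hemb : MeasurableEmbedding (fun x : ℝ³ => x + ((m : ℝ) * L) • eZ) :=
      (Homeomorph.addRight (((m : ℝ) * L) • (eZ : ℝ³))).measurableEmbedding
    have key := hmp.setIntegral_preimage_emb hemb f T
    rw [← key, preimage_add_smul_cylinderCell_slab]

/-! ### Integrability of periodic extensions on the `m`-fold cell -/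

/-- The axial reduction on the slab `{jL ≤ z < (j+1)L}` is the translation by `−jL e_z`. [folklore] -/
theorem axialRed_eq_sub_of_mem_slab (hL : 0 < L) (j : ℕ) {x : ℝ³} (h0 : (j : ℝ) * L ≤ x 2) (h1 : x 2 < (j : ℝ) * L + L) :
    axialRed L x = x - ((j : ℝ) * L) • eZ := by
  have hper : IsAxiallyPeriodic L (axialRed L) := isAxiallyPeriodic_axialRed hL
  have h := hper.add_int_mul_smul_eZ (-(j : ℤ)) x
  simp only [Int.cast_neg, Int.cast_natCast, neg_mul, neg_smul, ← sub_eq_add_neg] at h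
  rw [← h, axialRed_eq_self hL]
  · simp only [PiLp.sub_apply, smul_eZ_apply_two]; linarith
  · simp only [PiLp.sub_apply, smul_eZ_apply_two]; linarith

/-- **A function integrable on the cell has its periodic extension integrable on the `m`-fold cell.**
[folklore] -/
theorem integrableOn_comp_axialRed_multiPeriod (hL : 0 < L) {E : Type*} [NormedAddCommGroup E] (m : ℕ)
    {f : ℝ³ → E} (hf : IntegrableOn f (cylinderCell L : Set ℝ³) volume) :
    IntegrableOn (fun x => f (axialRed L x)) (cylinderCell ((m : ℝ) * L) : Set ℝ³) volume := by
  induction m with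
  | zero =>
    have h0 : (cylinderCell ((0 : ℕ) * L : ℝ) : Set ℝ³) = ∅ := by
      ext x
      simp only [Nat.cast_zero, zero_mul, SetLike.mem_coe, mem_cylinderCell, mem_empty_iff_false, iff_false]
      rintro ⟨-, h1, h2⟩; linarith
    rw [h0]; exact integrableOn_empty
  | succ m ih =>
    set S : Set ℝ³ := (cylinderCell ((m : ℝ) * L) : Set ℝ³) with hS
    set T : Set ℝ³ := {x : ℝ³ | cylRadius x < 1 ∧ (m : ℝ) * L < x 2 ∧ x 2 < (m : ℝ) * L + L} with hT
    have hc2 : Continuous fun x : ℝ³ => x 2 := (continuous_apply 2).comp (PiLp.continuous_ofLp 2 _)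
    have hTo : IsOpen T := (isOpen_lt continuous_cylRadius continuous_const).inter
      ((isOpen_lt continuous_const hc2).inter (isOpen_lt hc2 continuous_const))
    have hae : ((cylinderCell (((m + 1 : ℕ) : ℝ) * L) : Set ℝ³)) =ᵐ[volume] (S ∪ T : Set ℝ³) := by
      have hsub1 : S ∪ T ⊆ (cylinderCell (((m + 1 : ℕ) : ℝ) * L) : Set ℝ³) := by
        rintro x (⟨h1, h2, h3⟩ | ⟨h1, h2, h3⟩)
        · refine ⟨h1, h2, ?_⟩; push_cast; nlinarith
        · refine ⟨h1, by nlinarith [hL], ?_⟩; push_cast; linarith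
      have hsub2 : (cylinderCell (((m + 1 : ℕ) : ℝ) * L) : Set ℝ³) \ (S ∪ T) ⊆ {x : ℝ³ | x 2 = (m : ℝ) * L} := by
        rintro x ⟨⟨h1, h2, h3⟩, hx⟩
        rw [mem_union, not_or] at hx
        push_cast at h3
        rcases lt_trichotomy (x 2) ((m : ℝ) * L) with hlt | heq | hgt
        · exact absurd (show x ∈ S from ⟨h1, h2, hlt⟩) hx.1
        · exact heq
        · exact absurd (show x ∈ T from ⟨h1, hgt, by linarith⟩) hx.2
      refine ae_eq_set.2 ⟨?_, ?_⟩
      · exact measure_mono_null hsub2 (volume_setOf_apply_two_eq _)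
      · rw [Set.sdiff_eq_empty.2 hsub1, measure_empty]
    refine IntegrableOn.congr_set_ae (IntegrableOn.union ih ?_) hae
    -- on the slab, `f ∘ axialRed = f (· − mL e_z)`
    have hmp : MeasurePreserving (fun x : ℝ³ => x + (-((m : ℝ) * L)) • eZ) volume volume :=
      measurePreserving_add_right volume _
    have hemb : MeasurableEmbedding (fun x : ℝ³ => x + (-((m : ℝ) * L)) • eZ) :=
      (Homeomorph.addRight ((-((m : ℝ) * L)) • (eZ : ℝ³))).measurableEmbedding
    have hpre : (fun x : ℝ³ => x + (-((m : ℝ) * L)) • eZ) ⁻¹' (cylinderCell L : Set ℝ³) = T := by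
      have h := preimage_add_smul_cylinderCell_slab (-((m : ℝ) * L)) (L := L)
      ext x
      simp only [mem_preimage, hT, mem_setOf_eq, SetLike.mem_coe, mem_cylinderCell, cylRadius_add_smul_eZ,
        PiLp.add_apply, smul_eZ_apply_two]
      constructor
      · rintro ⟨h1, h2, h3⟩; exact ⟨h1, by linarith, by linarith⟩
      · rintro ⟨h1, h2, h3⟩; exact ⟨h1, by linarith, by linarith⟩
    have h1 : IntegrableOn (fun x => f (x + (-((m : ℝ) * L)) • eZ)) T volume := by
      rw [← hpre]
      exact (hmp.integrableOn_comp_preimage hemb).2 hf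
    refine h1.congr_fun (fun x hx => ?_) hTo.measurableSet
    rw [axialRed_eq_sub_of_mem_slab hL m hx.2.1.le hx.2.2, neg_smul, sub_eq_add_neg]

/-! ### Averaging over periods -/

/-- **The period average** `ψ̄ = Σ_{j<m} ψ(· + jL e_z)` of an `mL`-periodic function is `L`-periodic.
[folklore] -/
theorem isAxiallyPeriodic_sum_translates {F : Type*} [AddCommGroup F] {ψ : ℝ³ → F} (m : ℕ)
    (hψ : ∀ x, ψ (x + ((m : ℝ) * L) • eZ) = ψ x) :
    IsAxiallyPeriodic L fun x => ∑ j ∈ Finset.range m, ψ (x + ((j : ℝ) * L) • eZ) := by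
  intro x
  set f : ℕ → F := fun j => ψ (x + ((j : ℝ) * L) • eZ) with hf
  have h1 : ∀ j : ℕ, ψ (x + L • eZ + ((j : ℝ) * L) • eZ) = f (j + 1) := fun j => by
    simp only [hf]; congr 1; rw [add_assoc, ← add_smul]; push_cast; ring_nf
  show (∑ j ∈ Finset.range m, ψ (x + L • eZ + ((j : ℝ) * L) • eZ)) = ∑ j ∈ Finset.range m, f j
  simp only [h1]
  have e1 := Finset.sum_range_succ' f m
  have e2 := Finset.sum_range_succ f m
  have hm0 : f m = f 0 := by simp only [hf, Nat.cast_zero, zero_mul, zero_smul, add_zero]; exact hψ x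
  rw [e2, hm0] at e1
  exact (add_right_cancel e1).symm

/-- The period average of a smooth function is smooth. [folklore] -/
theorem contDiff_sum_translates {F : Type*} [NormedAddCommGroup F] [NormedSpace ℝ F] {ψ : ℝ³ → F}
    (hψ : ContDiff ℝ ∞ ψ) (m : ℕ) :
    ContDiff ℝ ∞ fun x => ∑ j ∈ Finset.range m, ψ (x + ((j : ℝ) * L) • eZ) :=
  ContDiff.sum fun _ _ => hψ.comp (contDiff_id.add contDiff_const)

/-- The derivative of the period average is the period average of the derivatives. [folklore] -/
theorem fderiv_sum_translates {F : Type*} [NormedAddCommGroup F] [NormedSpace ℝ F] {ψ : ℝ³ → F}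
    (hψ : ContDiff ℝ ∞ ψ) (m : ℕ) (x v : ℝ³) :
    fderiv ℝ (fun x => ∑ j ∈ Finset.range m, ψ (x + ((j : ℝ) * L) • eZ)) x v =
      ∑ j ∈ Finset.range m, fderiv ℝ ψ (x + ((j : ℝ) * L) • eZ) v := by
  have hd : ∀ j ∈ Finset.range m, DifferentiableAt ℝ (fun x => ψ (x + ((j : ℝ) * L) • eZ)) x := fun j _ =>
    ((hψ.differentiable (by simp)) _).comp x (differentiableAt_id.add (differentiableAt_const _))
  rw [fderiv_fun_sum hd]
  simp only [_root_.FunLike.coe_sum, Finset.sum_apply]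
  refine Finset.sum_congr rfl fun j _ => ?_
  rw [fderiv_comp_add_right]

/-- The Laplacian of the period average is the period average of the Laplacians. [folklore] -/
theorem laplacian_sum_translates {ψ : ℝ³ → ℝ} (hψ : ContDiff ℝ ∞ ψ) (m : ℕ) (x : ℝ³) :
    (Δ (fun x => ∑ j ∈ Finset.range m, ψ (x + ((j : ℝ) * L) • eZ))) x =
      ∑ j ∈ Finset.range m, (Δ ψ) (x + ((j : ℝ) * L) • eZ) := by
  rw [Torus.laplacian_finset_sum fun j _ => ?_]
  · exact Finset.sum_congr rfl fun j _ => Torus.laplacian_comp_add_right ψ _ x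
  · exact ((hψ.of_le (by norm_cast)).comp (contDiff_id.add contDiff_const)).contDiffAt

/-! ### The periodic extensions of the weak objects -/

/-- On the cell, the periodic extension `Q = q ∘ axialRed` of a function is invisible to shifts by
whole periods: `Q(x + jL e_z) = q x` for `x` in the cell. [folklore] -/
theorem comp_axialRed_add_nat_mul (hL : 0 < L) {F : Type*} (q : ℝ³ → F) (j : ℕ) {x : ℝ³}
    (hx : x ∈ (cylinderCell L : Set ℝ³)) : q (axialRed L (x + ((j : ℝ) * L) • eZ)) = q x := by
  have hper : IsAxiallyPeriodic L (fun y => q (axialRed L y)) := fun y => by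
    simp only [isAxiallyPeriodic_axialRed hL y]
  have := hper.add_int_mul_smul_eZ (j : ℤ) x
  simp only [Int.cast_natCast] at this
  rw [this, axialRed_eq_self_of_mem_cell hL hx]

/-- **The weak gradient of the potential on the `m`-fold cell**: for `G ∈ 𝓖` with potential `q`,
their periodic extensions `Q = q ∘ axialRed`, `G ∘ axialRed`, every `m ≥ 1` and every smooth
`mL`-periodic `ψ` vanishing near the wall,
`∫_{cell(mL)} ∂_vψ · Q = −∫_{cell(mL)} ψ ⟪G ∘ axialRed, v⟫` (slab decomposition and the period average,
which is `L`-periodic, reduce it to `setIntegral_fderiv_mul_potential_of_periodic`). [folklore] -/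
theorem setIntegral_fderiv_mul_potential_multiPeriod (hL : 0 < L) (G : gradSpace L) (m : ℕ) {ψ : ℝ³ → ℝ}
    (hψ : ContDiff ℝ ∞ ψ) (hψp : ∀ x, ψ (x + ((m : ℝ) * L) • eZ) = ψ x) {δ : ℝ} (hδ : 0 < δ)
    (hψ0 : ∀ x : ℝ³, 1 - δ ≤ cylRadius x → ψ x = 0) (v : ℝ³)
    (hQ : IntegrableOn (fun x => ((potential G : Lp ℝ 2 (cellMeasure L)) : ℝ³ → ℝ) (axialRed L x))
      (cylinderCell ((m : ℝ) * L) : Set ℝ³) volume)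
    (hG : IntegrableOn (fun x => (((G : gradSpace L) : Lp ℝ³ 2 (cellMeasure L)) : ℝ³ → ℝ³) (axialRed L x))
      (cylinderCell ((m : ℝ) * L) : Set ℝ³) volume) :
    ∫ x in (cylinderCell ((m : ℝ) * L) : Set ℝ³), fderiv ℝ ψ x v *
        ((potential G : Lp ℝ 2 (cellMeasure L)) : ℝ³ → ℝ) (axialRed L x) =
      -∫ x in (cylinderCell ((m : ℝ) * L) : Set ℝ³), ψ x *
        ⟪(((G : gradSpace L) : Lp ℝ³ 2 (cellMeasure L)) : ℝ³ → ℝ³) (axialRed L x), v⟫ := by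
  set q : ℝ³ → ℝ := ((potential G : Lp ℝ 2 (cellMeasure L)) : ℝ³ → ℝ) with hq
  set Gf : ℝ³ → ℝ³ := (((G : gradSpace L) : Lp ℝ³ 2 (cellMeasure L)) : ℝ³ → ℝ³) with hGf
  set ψbar : ℝ³ → ℝ := fun x => ∑ j ∈ Finset.range m, ψ (x + ((j : ℝ) * L) • eZ) with hψbar
  have hψbars : ContDiff ℝ ∞ ψbar := contDiff_sum_translates hψ m
  have hψbarp : IsAxiallyPeriodic L ψbar := isAxiallyPeriodic_sum_translates m hψp
  have hψbar0 : ∀ x : ℝ³, 1 - δ ≤ cylRadius x → ψbar x = 0 := fun x hx => by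
    simp only [hψbar]
    exact Finset.sum_eq_zero fun j _ => hψ0 _ (by rwa [cylRadius_add_smul_eZ])
  have key := setIntegral_fderiv_mul_potential_of_periodic hL G hψbars hψbarp hδ hψbar0 v
  -- left side: slab decomposition, then the shifts are invisible to `Q` on the cell
  have hQ' : IntegrableOn (fun x => fderiv ℝ ψ x v * q (axialRed L x)) (cylinderCell ((m : ℝ) * L) : Set ℝ³) volume := by
    obtain ⟨C, hC⟩ := exists_bound_on_cell (L := (m : ℝ) * L) ((hψ.continuous_fderiv (by simp)).clm_apply (continuous_const (y := v)))
    exact hQ.bdd_mul (((hψ.continuous_fderiv (by simp)).clm_apply (continuous_const (y := v))).aestronglyMeasurable)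
      (ae_restrict_of_forall_mem (cylinderCell _).isOpen.measurableSet hC)
  have hG' : IntegrableOn (fun x => ψ x * ⟪Gf (axialRed L x), v⟫) (cylinderCell ((m : ℝ) * L) : Set ℝ³) volume := by
    obtain ⟨C, hC⟩ := exists_bound_on_cell (L := (m : ℝ) * L) hψ.continuous
    exact (hG.inner_const v).bdd_mul hψ.continuous.aestronglyMeasurable
      (ae_restrict_of_forall_mem (cylinderCell _).isOpen.measurableSet hC)
  rw [setIntegral_cylinderCell_mul_eq_sum hL m hQ', setIntegral_cylinderCell_mul_eq_sum hL m hG']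
  have e1 : ∀ j ∈ Finset.range m, ∫ x in (cylinderCell L : Set ℝ³), fderiv ℝ ψ (x + ((j : ℝ) * L) • eZ) v *
      q (axialRed L (x + ((j : ℝ) * L) • eZ)) = ∫ x in (cylinderCell L : Set ℝ³), fderiv ℝ ψ (x + ((j : ℝ) * L) • eZ) v * q x :=
    fun j _ => setIntegral_congr_fun (cylinderCell L).isOpen.measurableSet fun x hx => by rw [comp_axialRed_add_nat_mul hL q j hx]
  have e2 : ∀ j ∈ Finset.range m, ∫ x in (cylinderCell L : Set ℝ³), ψ (x + ((j : ℝ) * L) • eZ) *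
      ⟪Gf (axialRed L (x + ((j : ℝ) * L) • eZ)), v⟫ = ∫ x in (cylinderCell L : Set ℝ³), ψ (x + ((j : ℝ) * L) • eZ) * ⟪Gf x, v⟫ :=
    fun j _ => setIntegral_congr_fun (cylinderCell L).isOpen.measurableSet fun x hx => by rw [comp_axialRed_add_nat_mul hL Gf j hx]
  rw [Finset.sum_congr rfl e1, Finset.sum_congr rfl e2]
  -- collect the sums into the period averages
  have I1 : ∀ j ∈ Finset.range m, Integrable (fun x => fderiv ℝ ψ (x + ((j : ℝ) * L) • eZ) v * q x) (cellMeasure L) := fun j _ =>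
    integrable_continuous_mul_coe (((hψ.continuous_fderiv (by simp)).comp (continuous_id.add continuous_const)).clm_apply
      (continuous_const (y := v))) _
  have I2 : ∀ j ∈ Finset.range m, Integrable (fun x => ψ (x + ((j : ℝ) * L) • eZ) * ⟪Gf x, v⟫) (cellMeasure L) := fun j _ =>
    integrable_continuous_mul_inner_coe (hψ.continuous.comp (continuous_id.add continuous_const)) _ v
  rw [← integral_finsetSum _ I1, ← integral_finsetSum _ I2]
  have l1 : ∫ x in (cylinderCell L : Set ℝ³), ∑ j ∈ Finset.range m, fderiv ℝ ψ (x + ((j : ℝ) * L) • eZ) v * q x =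
      ∫ x in (cylinderCell L : Set ℝ³), fderiv ℝ ψbar x v * q x :=
    integral_congr_ae (Eventually.of_forall fun x => by simp only [hψbar, fderiv_sum_translates (L := L) hψ m x v, Finset.sum_mul])
  have l2 : ∫ x in (cylinderCell L : Set ℝ³), ∑ j ∈ Finset.range m, ψ (x + ((j : ℝ) * L) • eZ) * ⟪Gf x, v⟫ =
      ∫ x in (cylinderCell L : Set ℝ³), ψbar x * ⟪Gf x, v⟫ :=
    integral_congr_ae (Eventually.of_forall fun x => by simp only [hψbar, Finset.sum_mul])
  rw [l1, l2]
  exact key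

/-- **The weak Laplacian of the cut-off potential on the `m`-fold cell**: with the data and cut-off
of `setIntegral_cutoff_potential_mul_laplacian`, the periodic extensions `Q = q ∘ axialRed`,
`F ∘ axialRed` of the potential and of `F = θ(div h₁ − h₀) + 2Dθ(∇q) + qΔθ`, and every smooth
`mL`-periodic `Φ`: `∫_{cell(mL)} θ Q ΔΦ = ∫_{cell(mL)} (F ∘ axialRed) Φ`. [folklore] -/
theorem setIntegral_cutoff_potential_mul_laplacian_multiPeriod (hL : 0 < L) {h₀ : ℝ³ → ℝ} {h₁ : ℝ³ → ℝ³}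
    (hh₀ : IsSmoothPeriodic L h₀) (hh₁ : IsSmoothPeriodic L h₁)
    (hmean : ∫ x in (cylinderCell L : Set ℝ³), h₀ x = 0) {θ : ℝ³ → ℝ} (hθ : ContDiff ℝ ∞ θ)
    (hθp : IsAxiallyPeriodic L θ) {δ : ℝ} (hδ : 0 < δ) (hθ0 : ∀ x : ℝ³, 1 - δ ≤ cylRadius x → θ x = 0)
    {m : ℕ} (hm : 1 ≤ m) {Φ : ℝ³ → ℝ} (hΦ : ContDiff ℝ ∞ Φ) (hΦp : ∀ x, Φ (x + ((m : ℝ) * L) • eZ) = Φ x)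
    (hQ : IntegrableOn (fun x => ((potential (neumannGrad L (toCell L h₀) (toCell L h₁)) : Lp ℝ 2 (cellMeasure L)) : ℝ³ → ℝ)
      (axialRed L x)) (cylinderCell ((m : ℝ) * L) : Set ℝ³) volume)
    (hF : IntegrableOn (fun x => (fun y => θ y * (VectorCalculus.divergence h₁ y - h₀ y) +
          2 * fderiv ℝ θ y ((((neumannGrad L (toCell L h₀) (toCell L h₁) : gradSpace L) :
            Lp ℝ³ 2 (cellMeasure L)) : ℝ³ → ℝ³) y) +
          ((potential (neumannGrad L (toCell L h₀) (toCell L h₁)) : Lp ℝ 2 (cellMeasure L)) : ℝ³ → ℝ) y * (Δ θ) y)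
        (axialRed L x)) (cylinderCell ((m : ℝ) * L) : Set ℝ³) volume) :
    ∫ x in (cylinderCell ((m : ℝ) * L) : Set ℝ³), θ x *
        ((potential (neumannGrad L (toCell L h₀) (toCell L h₁)) : Lp ℝ 2 (cellMeasure L)) : ℝ³ → ℝ) (axialRed L x) *
        (Δ Φ) x =
      ∫ x in (cylinderCell ((m : ℝ) * L) : Set ℝ³),
        (fun y => θ y * (VectorCalculus.divergence h₁ y - h₀ y) +
          2 * fderiv ℝ θ y ((((neumannGrad L (toCell L h₀) (toCell L h₁) : gradSpace L) :
            Lp ℝ³ 2 (cellMeasure L)) : ℝ³ → ℝ³) y) +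
          ((potential (neumannGrad L (toCell L h₀) (toCell L h₁)) : Lp ℝ 2 (cellMeasure L)) : ℝ³ → ℝ) y * (Δ θ) y)
        (axialRed L x) * Φ x := by
  set Gg : gradSpace L := neumannGrad L (toCell L h₀) (toCell L h₁) with hGg
  set q : ℝ³ → ℝ := ((potential Gg : Lp ℝ 2 (cellMeasure L)) : ℝ³ → ℝ) with hq
  set Gf : ℝ³ → ℝ³ := (((Gg : gradSpace L) : Lp ℝ³ 2 (cellMeasure L)) : ℝ³ → ℝ³) with hGf
  set F : ℝ³ → ℝ := fun y => θ y * (VectorCalculus.divergence h₁ y - h₀ y) + 2 * fderiv ℝ θ y (Gf y) + q y * (Δ θ) y with hFdef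
  set Φbar : ℝ³ → ℝ := fun x => ∑ j ∈ Finset.range m, Φ (x + ((j : ℝ) * L) • eZ) with hΦbar
  have hΦbars : ContDiff ℝ ∞ Φbar := contDiff_sum_translates hΦ m
  have hΦbarp : IsAxiallyPeriodic L Φbar := isAxiallyPeriodic_sum_translates m hΦp
  have key := setIntegral_cutoff_potential_mul_laplacian hL hh₀ hh₁ hmean hθ hθp hδ hθ0 hΦbars hΦbarp
  have hΦ2 : ContDiff ℝ 2 Φ := hΦ.of_le (by norm_cast)
  have hΔΦc : Continuous (Δ Φ) := by
    rw [funext (laplacian_eq_sum_fderiv_fderiv hΦ2)]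
    exact continuous_finsetSum _ fun i _ =>
      (SobolevApprox.contDiff_infty_fderiv_apply (SobolevApprox.contDiff_infty_fderiv_apply hΦ _) _).continuous
  -- integrability on the big cell
  have hL' : IntegrableOn (fun x => θ x * q (axialRed L x) * (Δ Φ) x) (cylinderCell ((m : ℝ) * L) : Set ℝ³) volume := by
    obtain ⟨C1, hC1⟩ := exists_bound_on_cell (L := (m : ℝ) * L) hθ.continuous
    obtain ⟨C2, hC2⟩ := exists_bound_on_cell (L := (m : ℝ) * L) hΔΦc
    have h1 : IntegrableOn (fun x => θ x * q (axialRed L x)) (cylinderCell ((m : ℝ) * L) : Set ℝ³) volume :=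
      hQ.bdd_mul hθ.continuous.aestronglyMeasurable (ae_restrict_of_forall_mem (cylinderCell _).isOpen.measurableSet hC1)
    have h2 := h1.mul_bdd hΔΦc.aestronglyMeasurable (ae_restrict_of_forall_mem (cylinderCell _).isOpen.measurableSet hC2)
    exact h2
  have hR' : IntegrableOn (fun x => F (axialRed L x) * Φ x) (cylinderCell ((m : ℝ) * L) : Set ℝ³) volume := by
    obtain ⟨C, hC⟩ := exists_bound_on_cell (L := (m : ℝ) * L) hΦ.continuous
    exact hF.mul_bdd hΦ.continuous.aestronglyMeasurable (ae_restrict_of_forall_mem (cylinderCell _).isOpen.measurableSet hC)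
  rw [setIntegral_cylinderCell_mul_eq_sum hL m hL', setIntegral_cylinderCell_mul_eq_sum hL m hR']
  have e1 : ∀ j ∈ Finset.range m, ∫ x in (cylinderCell L : Set ℝ³), θ (x + ((j : ℝ) * L) • eZ) *
      q (axialRed L (x + ((j : ℝ) * L) • eZ)) * (Δ Φ) (x + ((j : ℝ) * L) • eZ) =
      ∫ x in (cylinderCell L : Set ℝ³), θ x * q x * (Δ Φ) (x + ((j : ℝ) * L) • eZ) :=
    fun j _ => setIntegral_congr_fun (cylinderCell L).isOpen.measurableSet fun x hx => by
      have hθj := hθp.add_int_mul_smul_eZ (j : ℤ) x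
      simp only [Int.cast_natCast] at hθj
      simp only [comp_axialRed_add_nat_mul hL q j hx, hθj]
  have e2 : ∀ j ∈ Finset.range m, ∫ x in (cylinderCell L : Set ℝ³), F (axialRed L (x + ((j : ℝ) * L) • eZ)) *
      Φ (x + ((j : ℝ) * L) • eZ) = ∫ x in (cylinderCell L : Set ℝ³), F x * Φ (x + ((j : ℝ) * L) • eZ) :=
    fun j _ => setIntegral_congr_fun (cylinderCell L).isOpen.measurableSet fun x hx => by rw [comp_axialRed_add_nat_mul hL F j hx]
  rw [Finset.sum_congr rfl e1, Finset.sum_congr rfl e2]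
  have I1 : ∀ j ∈ Finset.range m, Integrable (fun x => θ x * q x * (Δ Φ) (x + ((j : ℝ) * L) • eZ)) (cellMeasure L) := fun j _ => by
    have hc : Continuous fun x => θ x * (Δ Φ) (x + ((j : ℝ) * L) • eZ) := hθ.continuous.mul (hΔΦc.comp (continuous_id.add continuous_const))
    exact (integrable_continuous_mul_coe hc (potential Gg : Lp ℝ 2 (cellMeasure L))).congr (Eventually.of_forall fun x => by
      simp only [hq]; ring)
  have hFi : IntegrableOn F (cylinderCell L : Set ℝ³) volume := by
    have h1m : (1 : ℝ) ≤ m := by exact_mod_cast hm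
    have hLm : L ≤ (m : ℝ) * L := by nlinarith
    have hsub : (cylinderCell L : Set ℝ³) ⊆ cylinderCell ((m : ℝ) * L) := fun x hx =>
      ⟨hx.1, hx.2.1, lt_of_lt_of_le hx.2.2 hLm⟩
    exact (hF.mono_set hsub).congr_fun (fun x hx => by simp only [axialRed_eq_self_of_mem_cell hL hx])
      (cylinderCell L).isOpen.measurableSet
  have I2 : ∀ j ∈ Finset.range m, Integrable (fun x => F x * Φ (x + ((j : ℝ) * L) • eZ)) (cellMeasure L) := fun j _ => by
    obtain ⟨C, hC⟩ := exists_bound_on_cell (L := L) (hΦ.continuous.comp (continuous_id.add continuous_const) :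
      Continuous fun x => Φ (x + ((j : ℝ) * L) • eZ))
    exact hFi.mul_bdd (hΦ.continuous.comp (continuous_id.add continuous_const)).aestronglyMeasurable
      (ae_restrict_of_forall_mem (cylinderCell L).isOpen.measurableSet hC)
  rw [← integral_finsetSum _ I1, ← integral_finsetSum _ I2]
  have l1 : ∫ x in (cylinderCell L : Set ℝ³), ∑ j ∈ Finset.range m, θ x * q x * (Δ Φ) (x + ((j : ℝ) * L) • eZ) =
      ∫ x in (cylinderCell L : Set ℝ³), θ x * q x * (Δ Φbar) x :=
    integral_congr_ae (Eventually.of_forall fun x => by simp only [hΦbar, laplacian_sum_translates (L := L) hΦ m x, Finset.mul_sum])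
  have l2 : ∫ x in (cylinderCell L : Set ℝ³), ∑ j ∈ Finset.range m, F x * Φ (x + ((j : ℝ) * L) • eZ) =
      ∫ x in (cylinderCell L : Set ℝ³), F x * Φbar x :=
    integral_congr_ae (Eventually.of_forall fun x => by simp only [hΦbar, Finset.mul_sum])
  rw [l1, l2]
  exact key

end PeriodicCylinder

end Literature.Analysis.FluidPDE
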